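import Mathlib
import Summits.ValiantsHypothesis.ValiantsHypothesis.Theorems.NewtonUnitEquationsDissociatedFixedKExposedWord

/-!
# Crux `NewtonUnitEquations.DissociatedUniform` (stmt-ValiantsHypothesis-5905), line
`greedy-basis-shadow` — stub `stub_topSurvivorGreedy` (stub B, the greedy-word lemma)

Setting: `k` products of `m` bivariate polynomials `f i j : MvPolynomial (Fin 2) ℂ` on a DISSOCIATED
frame, i.e. `supp (f i j) ⊆ A j` and the sum map `a ↦ ∑ j, a j` is injective on the word box
`Π_j A j = Fintype.piFinset A`.  Every word `a` carries a planar point `pt a = ∑ j, a j` and a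
Khatri–Rao column `col a = (i ↦ ∏ j, coeff (a j) (f i j)) ∈ ℂ^k`.

The dictionary of the sibling crux `DissociatedFixedK` (file
`NewtonUnitEquationsDissociatedFixedKExposedWord.lean`, namespace
`Summit.ValiantsHypothesis.Theorems.DissociatedFixedK`) is reused, not re-derived:
`prod_eq_sum_piFinset` (expansion `∏ j, f i j = ∑_{a ∈ piFinset A} (∏ j, coeff (a j) (f i j)) • X^(pt a)`),
`coeff_sum_prod_of_dissociated` (`coeff (pt a) (∑ i, ∏ j, f i j) = ∑ i, col a i` for every word `a`)
and `exists_word_of_mem_support` (every support exponent is `pt a` for a word `a` with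
`∑ i, col a i ≠ 0`).  This file adds

* `TopSurvivorGreedy.support_sum_prod_subset_image`: `supp (∑ i, ∏ j, f i j) ⊆ pt '' (piFinset A)`
  (needs only `supp (f i j) ⊆ A j`);
* `TopSurvivorGreedy.not_mem_span_of_functional`: a functional killing `S` but not `v` keeps `v` out of
  `span S`;
* `stub_topSurvivorGreedy` (the registered stub): if `e₀ ∈ supp F` is the STRICT maximiser on `supp F`
  of the height `s ↦ ∑ i, w i * s i`, then `e₀ = pt a₀` for a word `a₀` which is GREEDY in direction
  `w`: `col a₀` is not in the span of the columns of the strictly higher words.  Indeed a strictly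
  higher word `b` has `pt b ∉ supp F` (it would beat the strict maximiser), so the functional
  `x ↦ ∑ i, x i` kills `col b`, hence kills the whole span (`Submodule.span_le` into its kernel), but
  `∑ i, col a₀ i = coeff e₀ F ≠ 0`.  No genericity of `w` is needed.
-/

open scoped BigOperators
open MvPolynomial
open Summit.ValiantsHypothesis.Theorems.DissociatedFixedK (prod_eq_sum_piFinset
  coeff_sum_prod_of_dissociated exists_word_of_mem_support)

-- Sub = Summit single-conjunct layout: the duplicated namespace component is mandated by the tree.
set_option linter.dupNamespace false

namespace Summit.ValiantsHypothesis.ValiantsHypothesis.Theorems.NewtonUnitEquationsDissociatedUniform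

namespace TopSurvivorGreedy

/-- **Support formula.**  With `supp (f i j) ⊆ A j`, the support of `∑ i, ∏ j, f i j` lies in the
image of the word box `Π_j A_j` under the sum map `g ↦ ∑ j, g j`. [folklore] -/
theorem support_sum_prod_subset_image {R : Type*} [CommSemiring R] {σ : Type*} [DecidableEq σ]
    {k m : ℕ} (A : Fin m → Finset (σ →₀ ℕ)) (f : Fin k → Fin m → MvPolynomial σ R)
    (hsupp : ∀ i j, (f i j).support ⊆ A j) :
    (∑ i, ∏ j, f i j).support ⊆ (Fintype.piFinset A).image (fun g => ∑ j, g j) := by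
  -- adapted from NewtonUnitEquationsDissociatedFixedKExposedWord.lean, proof of
  -- `exists_word_of_mem_support` (its local `hsub`)
  refine (MvPolynomial.support_sum).trans ?_
  intro e' he'
  simp only [Finset.mem_biUnion, Finset.mem_univ, true_and] at he'
  obtain ⟨i, hi⟩ := he'
  rw [prod_eq_sum_piFinset A (f i) (hsupp i)] at hi
  have := MvPolynomial.support_sum hi
  simp only [Finset.mem_biUnion] at this
  obtain ⟨g, hg, hge⟩ := this
  have := support_monomial_subset hge
  simp only [Finset.mem_singleton] at this
  exact Finset.mem_image.mpr ⟨g, hg, this.symm⟩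

/-- **The abstract lever.**  If a linear functional `φ` kills every vector of a set `S` but not `v`,
then `v` is not in the span of `S` (`Submodule.span_le` into `LinearMap.ker φ`). [folklore] -/
theorem not_mem_span_of_functional {K V : Type*} [Field K] [AddCommGroup V] [Module K V]
    (φ : V →ₗ[K] K) {S : Set V} {v : V} (hS : ∀ x ∈ S, φ x = 0) (hv : φ v ≠ 0) :
    v ∉ Submodule.span K S := by
  intro hmem
  have hle : Submodule.span K S ≤ LinearMap.ker φ :=
    Submodule.span_le.mpr fun x hx => LinearMap.mem_ker.mpr (hS x hx)
  exact hv (LinearMap.mem_ker.mp (hle hmem))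

/-- The coordinate-sum functional `x ↦ ∑ i, x i` on `Fin k → ℂ`. [folklore] -/
theorem sumFunctional_apply (k : ℕ) (x : Fin k → ℂ) :
    (∑ i : Fin k, (LinearMap.proj i : (Fin k → ℂ) →ₗ[ℂ] ℂ)) x = ∑ i, x i := by
  rw [LinearMap.sum_apply]
  rfl

end TopSurvivorGreedy

open TopSurvivorGreedy in
/-- **`stub_topSurvivorGreedy`** (crux `DissociatedUniform`, line `greedy-basis-shadow`, stub B =
`TopSurvivorGreedy` unfolded — the greedy-word lemma).  On a dissociated frame (`supp (f i j) ⊆ A j`,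
sum map injective on `Π_j A_j`), if `e₀ ∈ supp (∑ i, ∏ j, f i j)` is the STRICT maximiser on the
support of the height `s ↦ ∑ i, w i * s i`, then `e₀ = ∑ j, a₀ j` for a word `a₀ ∈ Π_j A_j` whose
Khatri–Rao column `i ↦ ∏ j, coeff (a₀ j) (f i j)` is NOT in the span of the columns of the words of
strictly larger height (i.e. `a₀` is greedy in direction `w`).  Proof: by the dictionary
`coeff (∑ j, b j) F = ∑ i, col b i`; a strictly higher word `b` has `∑ j, b j ∉ supp F` (else `hmax`
contradicts its height), so the functional `x ↦ ∑ i, x i` kills `col b` and hence the span, but not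
`col a₀` (`coeff e₀ F ≠ 0`).  No genericity of `w` is needed. [folklore] -/
theorem stub_topSurvivorGreedy (k m : ℕ) (A : Fin m → Finset (Fin 2 →₀ ℕ))
    (f : Fin k → Fin m → MvPolynomial (Fin 2) ℂ) (w : Fin 2 → ℝ) (e₀ : Fin 2 →₀ ℕ)
    (hsupp : ∀ i j, (f i j).support ⊆ A j)
    (hdis : ∀ a b : Fin m → (Fin 2 →₀ ℕ), (∀ j, a j ∈ A j) → (∀ j, b j ∈ A j) → ∑ j, a j = ∑ j, b j → a = b)
    (he₀ : e₀ ∈ (∑ i, ∏ j, f i j).support)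
    (hmax : ∀ s ∈ (∑ i, ∏ j, f i j).support, s ≠ e₀ →
      (∑ i, w i * ((s i : ℕ) : ℝ)) < ∑ i, w i * ((e₀ i : ℕ) : ℝ)) :
    ∃ a₀ ∈ Fintype.piFinset A, ∑ j, a₀ j = e₀ ∧
      a₀ ∈ {a : Fin m → (Fin 2 →₀ ℕ) | a ∈ Fintype.piFinset A ∧
          (fun i => ∏ j, (f i j).coeff (a j)) ∉ Submodule.span ℂ
            ((fun b : Fin m → (Fin 2 →₀ ℕ) => fun i => ∏ j, (f i j).coeff (b j)) ''
              {b | b ∈ Fintype.piFinset A ∧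
                (∑ i, w i * (((∑ j, a j) i : ℕ) : ℝ)) < ∑ i, w i * (((∑ j, b j) i : ℕ) : ℝ)})} := by
  classical
  obtain ⟨a₀, ha₀, hpt, hT⟩ := exists_word_of_mem_support A f hsupp hdis he₀
  refine ⟨a₀, Fintype.mem_piFinset.mpr ha₀, hpt, ?_⟩
  rw [Set.mem_setOf_eq]
  refine ⟨Fintype.mem_piFinset.mpr ha₀, ?_⟩
  refine not_mem_span_of_functional (∑ i : Fin k, (LinearMap.proj i : (Fin k → ℂ) →ₗ[ℂ] ℂ)) ?_ ?_
  · rintro _ ⟨b, ⟨hb, hlt⟩, rfl⟩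
    rw [sumFunctional_apply,
      ← coeff_sum_prod_of_dissociated A f hsupp hdis b (Fintype.mem_piFinset.mp hb),
      ← notMem_support_iff]
    intro hbsupp
    rw [hpt] at hlt
    have hne : ∑ j, b j ≠ e₀ := by
      rintro h
      rw [h] at hlt
      exact lt_irrefl _ hlt
    exact lt_asymm hlt (hmax _ hbsupp hne)
  · rw [sumFunctional_apply]
    exact hT

end Summit.ValiantsHypothesis.ValiantsHypothesis.Theorems.NewtonUnitEquationsDissociatedUniform
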